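import Summits.Ventures.HodgeRepro2.T5HermitianDiagonalSign
import Summits.Ventures.HodgeRepro2.T5HasseNormOfHasseMinkowski

/-!
# Tools for Landherr's theorem in every rank (cell pub-hodge-repro2, seat p3)

Tier-5 N2 support, rows N2.2.7 / N2.2.9 / N2.8.1 of route/T5-N2-route-3.md; the bookkeeping lemmas of file 173
(Landherr's uniqueness in every rank from O'Meara 66:1 + 63:19):
* `formVal_diagonal`: the quadratic value of a diagonal hermitian form is `∑ dᵢ wᵢ w̄ᵢ`;
* `card_filter_pos_comp_equiv`, `card_filter_pos_sum_elim`: counts of positive entries under reindexing and on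
  a sum type;
* `map_diagonal_lift`, `map_diagonal_embedding`: the image of `diag(a)`, `a : ι → K⁺`, under the lift of a real
  embedding `ψ : K⁺ → ℝ`, resp. under any embedding `φ : K → ℂ`, is the real diagonal matrix `diag(ψ a)`;
* `locallyCongruent_congr_left/right`: local congruence is transported along a global congruence (file 156's
  `localize` is star-compatible);
* `isHermitian_diagonal_algebraMap`, `isUnit_det_diagonal_algebraMap`, `one_add_star_one_ne_zero'`;
* **`exists_det_eq_mul_norm_of_OMeara66_1`** — two Gram matrices congruent at every place have a determinant ratio
  which is a global norm: the Hasse norm theorem of file 167 (O'Meara 66:1) on the ratio `det H' / det H ∈ K⁺`.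

Mathlib + this seat's files 134 / 154 / 156 / 161 / 164 / 166 / 167 and their imports; no new display; no device.
§8(d): uses an L-value-free non-vanishing device: NO.
-/

namespace Summit.Ventures.HodgeRepro2.T5LandherrGeneralTools

open Matrix Finset NumberField NumberField.IsCMField IsDedekindDomain IsDedekindDomain.HeightOneSpectrum
open Summit.Ventures.HodgeRepro2.T5HasseMinkowskiDisplays Summit.Ventures.HodgeRepro2.T5HermitianDiagonalSign
  Summit.Ventures.HodgeRepro2.T5HasseNormOfHasseMinkowski
  Summit.Ventures.HodgeRepro2.T5LandherrInvariants Summit.Ventures.HodgeRepro2.T5LandherrInvariantsIff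
  Summit.Ventures.HodgeRepro2.T5HermitianGlobalChain Summit.Ventures.HodgeRepro2.T5HermitianDetClass
  Summit.Ventures.HodgeRepro2.T5HermitianDiagonalize Summit.Ventures.HodgeRepro2.T5HermitianClassify
  Summit.Ventures.HodgeRepro2.T5FinitePlaceSplitClassification Summit.Ventures.HodgeRepro2.T5GramSignature
  Summit.Ventures.HodgeRepro2.T5LandherrRankOne Summit.Ventures.HodgeRepro2.T6.B1Carriers

/-! ## Bookkeeping -/

section Tools

variable {E : Type*} [Field E] [StarRing E] {ι : Type*} [Fintype ι] [DecidableEq ι]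

/-- The value of the diagonal hermitian form `diag(d)` at `w` is `∑ dᵢ wᵢ w̄ᵢ`. -/
theorem formVal_diagonal (d w : ι → E) : formVal (diagonal d) w = ∑ i, d i * (w i * star (w i)) := by
  unfold formVal
  simp only [dotProduct, mulVec_diagonal, Pi.star_apply]
  refine Finset.sum_congr rfl fun i _ => ?_
  ring

omit [DecidableEq ι] in
/-- The number of positive entries is invariant under reindexing. -/
theorem card_filter_pos_comp_equiv {κ : Type*} [Fintype κ] (e : κ ≃ ι) (r : ι → ℝ) :
    (univ.filter fun k => 0 < r (e k)).card = (univ.filter fun i => 0 < r i).card := by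
  rw [Finset.card_filter, Finset.card_filter]
  exact Fintype.sum_equiv e _ _ fun k => rfl

/-- The number of positive entries of `Sum.elim f g` is the sum of the two counts. -/
theorem card_filter_pos_sum_elim {α β : Type*} [Fintype α] [Fintype β] (f : α → ℝ) (g : β → ℝ) :
    (univ.filter fun s => 0 < Sum.elim f g s).card =
      (univ.filter fun a => 0 < f a).card + (univ.filter fun b => 0 < g b).card := by
  rw [Finset.card_filter, Finset.card_filter, Finset.card_filter, Fintype.sum_sum_type]
  congr 1

end Tools

section CMTools

variable {K : Type*} [Field K] [NumberField K] [IsCMField K]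

/-- The image of `diag(a)`, `a : ι → K⁺`, under the lift `K → ℂ` of a real embedding `ψ : K⁺ → ℝ` is the real
diagonal matrix `diag(ψ a)`. -/
theorem map_diagonal_lift {ι : Type*} [Fintype ι] [DecidableEq ι] (ψ : maximalRealSubfield K →+* ℝ)
    (a : ι → maximalRealSubfield K) :
    (diagonal fun i => algebraMap (maximalRealSubfield K) K (a i)).map
        (ComplexEmbedding.lift K (Complex.ofRealHom.comp ψ)) =
      diagonal fun i => ((ψ (a i) : ℝ) : ℂ) := by
  rw [diagonal_map (map_zero _)]
  congr 1
  funext i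
  rw [ComplexEmbedding.lift_algebraMap_apply, RingHom.comp_apply, Complex.ofRealHom_eq_coe]

/-- Local congruence is transported along a global congruence on the left. -/
theorem locallyCongruent_congr_left (v : HeightOneSpectrum (𝓞 (maximalRealSubfield K)))
    {ι : Type*} [Fintype ι] [DecidableEq ι] {H H₁ H₂ : Matrix ι ι K} (h : IsCongruent H H₁) :
    LocallyCongruent K v H H₂ ↔ LocallyCongruent K v H₁ H₂ := by
  rw [locallyCongruent_iff, locallyCongruent_iff]
  letI := tensorStarRing K v
  have h' := isCongruent_map_of_star_comm (localize K v) (localize_star K v) h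
  exact ⟨fun hh => h'.symm.trans hh, fun hh => h'.trans hh⟩

/-- Local congruence is transported along a global congruence on the right. -/
theorem locallyCongruent_congr_right (v : HeightOneSpectrum (𝓞 (maximalRealSubfield K)))
    {ι : Type*} [Fintype ι] [DecidableEq ι] {H H₁ H₂ : Matrix ι ι K} (h : IsCongruent H₁ H₂) :
    LocallyCongruent K v H H₁ ↔ LocallyCongruent K v H H₂ := by
  rw [locallyCongruent_iff, locallyCongruent_iff]
  letI := tensorStarRing K v
  have h' := isCongruent_map_of_star_comm (localize K v) (localize_star K v) h
  exact ⟨fun hh => hh.trans h', fun hh => hh.trans h'.symm⟩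

/-- `diag(a)` for `a : ι → K⁺` is hermitian. -/
theorem isHermitian_diagonal_algebraMap {ι : Type*} [Fintype ι] [DecidableEq ι]
    (a : ι → maximalRealSubfield K) :
    (diagonal fun i => algebraMap (maximalRealSubfield K) K (a i)).IsHermitian :=
  isHermitian_diagonal_iff.mpr fun i => complexConj_apply_eq_self K (a i)

omit [NumberField K] [IsCMField K] in
/-- `diag(a)` for `a : ι → K⁺` with non-zero entries is invertible. -/
theorem isUnit_det_diagonal_algebraMap {ι : Type*} [Fintype ι] [DecidableEq ι]
    {a : ι → maximalRealSubfield K} (ha0 : ∀ i, a i ≠ 0) :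
    IsUnit (diagonal fun i => algebraMap (maximalRealSubfield K) K (a i)).det := by
  rw [det_diagonal, isUnit_iff_ne_zero, Finset.prod_ne_zero_iff]
  exact fun i _ => (map_ne_zero _).mpr (ha0 i)

/-- **The determinant ratio of two Gram matrices congruent at every place is a global norm** — from the Hasse
norm theorem of file 167 (O'Meara 66:1). -/
theorem exists_det_eq_mul_norm_of_OMeara66_1 (hHM : OMeara1963_66_1 (maximalRealSubfield K))
    {ι : Type*} [Fintype ι] [DecidableEq ι] {H H' : Matrix ι ι K}
    (hH : H.IsHermitian) (hH' : H'.IsHermitian) (hdet : IsUnit H.det) (hdet' : IsUnit H'.det)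
    (hloc : ∀ v : HeightOneSpectrum (𝓞 (maximalRealSubfield K)), LocallyCongruent K v H H')
    (hreal : ∀ φ : K →+* ℂ, IsCongruent (H.map φ) (H'.map φ)) :
    ∃ z : K, z ≠ 0 ∧ H'.det = z * star z * H.det := by
  obtain ⟨θ, y, hθ, hy⟩ := exists_datum K
  obtain ⟨d, hd⟩ : ∃ d : maximalRealSubfield K, algebraMap (maximalRealSubfield K) K d = H.det :=
    ⟨⟨H.det, det_mem_maximalRealSubfield hH⟩, rfl⟩
  obtain ⟨d', hd'⟩ : ∃ d' : maximalRealSubfield K, algebraMap (maximalRealSubfield K) K d' = H'.det :=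
    ⟨⟨H'.det, det_mem_maximalRealSubfield hH'⟩, rfl⟩
  have hd0 : d ≠ 0 := by
    rintro rfl
    rw [map_zero] at hd
    exact hdet.ne_zero hd.symm
  have hd0' : d' ≠ 0 := by
    rintro rfl
    rw [map_zero] at hd'
    exact hdet'.ne_zero hd'.symm
  have hc0 : d' / d ≠ 0 := div_ne_zero hd0' hd0
  have hc' : H'.det = algebraMap (maximalRealSubfield K) K (d' / d) * H.det := by
    rw [← hd, ← hd', map_div₀, div_mul_cancel₀ _ ((map_ne_zero _).mpr hd0)]
  have hfin : ∀ v : HeightOneSpectrum (𝓞 (maximalRealSubfield K)),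
      hilbertFin (maximalRealSubfield K) v (d' / d) θ = 1 :=
    fun v => (hilbertFin_eq_one_iff_locallyCongruent hθ hy v hH hH' hdet hdet' hc0 hc').mpr (hloc v)
  have hpos : ∀ φ : K →+* ℂ, 0 < (φ (algebraMap (maximalRealSubfield K) K (d' / d))).re :=
    fun φ => re_pos_of_isCongruent_map hdet hc' (φ.comp (algebraMap (maximalRealSubfield K) K)) φ rfl (hreal φ)
  obtain ⟨z, hz⟩ := exists_mul_star_eq_of_OMeara66_1 hθ hy hHM hc0 hfin hpos
  have hz0 : z ≠ 0 := by
    rintro rfl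
    rw [zero_mul, eq_comm, map_eq_zero] at hz
    exact hc0 hz
  exact ⟨z, hz0, by rw [hc', hz]⟩

omit [IsCMField K] in
/-- The image of `diag(a)`, `a : ι → K⁺`, under any embedding `φ : K → ℂ` is the real diagonal matrix `diag(ψ a)`,
`ψ` the real embedding of `K⁺` induced by `φ` (`K⁺` is totally real). -/
theorem map_diagonal_embedding {ι : Type*} [Fintype ι] [DecidableEq ι] (φ : K →+* ℂ)
    (a : ι → maximalRealSubfield K) :
    (diagonal fun i => algebraMap (maximalRealSubfield K) K (a i)).map φ =
      diagonal fun i => (((IsTotallyReal.complexEmbedding_isReal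
        (φ.comp (algebraMap (maximalRealSubfield K) K))).embedding (a i) : ℝ) : ℂ) := by
  rw [diagonal_map (map_zero _)]
  congr 1
  funext i
  rw [ComplexEmbedding.IsReal.coe_embedding_apply, RingHom.comp_apply]

/-- `1 + star 1 ≠ 0` in `K` (file 129's diagonalisation input). -/
theorem one_add_star_one_ne_zero' : ∃ μ : K, μ + star μ ≠ 0 :=
  ⟨1, by rw [star_one, one_add_one_eq_two]; exact two_ne_zero⟩

end CMTools

end Summit.Ventures.HodgeRepro2.T5LandherrGeneralTools
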